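import Summits.QuantumAdvantage.AdviceFreeQNC0.OutHeavy
import Summits.QuantumAdvantage.AdviceFreeQNC0.OutHeavyStarMain
import HarnessLib

/-!
# Cell qa-qnc0 (rung F-Q1, density axis): the finite facts `OutHeavyEight`, `OutHeavySeven` (Sketch14 §OutHeavy,
# ask L31) and the first FAR-REGIME theorem `OneWordMIEight` — kernel

Planner qa-qnc0-p1 gen 14 (ROUND-13 §1, Sketch14 §OutHeavy) reduced ONE-WORD MI at `m = 8` to one finite fact:
`OutHeavyEight` — at every symmetric optimum `K0` of `C_8` there is a minimum word `c` such that every non-zero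
codeword `Y ≠ c` has at least `failCount K0 = |Z(K0)| = 45` points OUTSIDE `Z(K0)`.  qn-prover g8 landed the
vocabulary (`OutHeavyStar.lean`: `OutHeavyButOne`, `OutHeavyEight`, `OutHeavySeven`, `OneWordMIEight`) and the chain
`oneWordMIEight_of_outHeavyEight : OutHeavyEight → OneWordMIEight` (`OutHeavyStarMain.lean`, Lemma G′ repaired with
SC₁); qn-lit g12 landed the raw counts by the orbit-counting engine (`OutHeavy.lean`: `SymCount.outHeavy_eight`,
`outHeavy_eightB`, `outHeavy_seven`, `isMinWord_cEight`, `opt_seven`; `SymmetricUniqueness.lean`: `opt_eight`).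
This file assembles them (no new computation):

* `failCount_of_isOpt1_eight` — every optimal codeword of `C_8` has exactly `45` zeros;
* `outHeavyButOne_eight` / `outHeavyButOne_eightB` — `OutHeavyButOne 8 K0 cEight` at the two optima;
* **`outHeavyEight : OutHeavyEight`**, **`outHeavySeven : OutHeavySeven`** (Sketch14, verbatim statements; the
  `IsSymPat` hypotheses are not used — `opt_eight` / `opt_seven` classify the optima among ALL codewords);
* **`oneWordMIEight : OneWordMIEight`** — ONE-WORD MI at `m = 8`, the planner's "smallest open case of the far
  regime", is a kernel theorem; `starCert_of_isOpt1_eight` — (★)(8, K0) at every optimal `K0`;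
  `starCert_seven`, `oneWordMIAt_seven` — the same at `m = 7` (`K0 = symWordB 7`, no exceptional word).

WHAT THIS IS NOT: `MassIneqAll` / `CertFifteen` / `TransportFifteen` (the far regime proper) OPEN; MULT₁ and α
(`RingToElim`, stmt-QuantumAdvantage-19119) untouched; separation NOT moved.
-/

namespace Summit.QuantumAdvantage.AdviceFreeQNC0

open Finset
open MassInequality SymCount

/-! ### m = 8 -/

/-- Every optimal codeword of `C_8` has exactly `45 = w(8,1)` zeros. -/
theorem failCount_of_isOpt1_eight {K0 : (Fin 8 → Bool) → Bool} (hK : IsOpt1 8 K0) : failCount K0 = 45 := by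
  apply le_antisymm
  · have h := hK.2 _ (isElim1_symWord 8 true)
    rwa [failCount_symWord_eight] at h
  · have h := isOpt1_symWord_eight.2 _ hK.1
    rwa [failCount_symWord_eight] at h

/-- `OutHeavyButOne 8 (symWord 8 true) cEight`: at the first optimum every non-zero codeword other than the minimum
word `cEight` has `≥ 45` outside points. -/
theorem outHeavyButOne_eight : OutHeavyButOne 8 (symWord 8 true) cEight := by
  refine ⟨isMinWord_cEight.1, fun Y hY hY0 hne => ?_⟩
  rw [failCount_symWord_eight]
  exact outHeavy_eight Y hY hY0 hne

/-- `failCount (symWordB 8) = 45` (the second optimum). -/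
theorem failCount_symWordB_eight : failCount (symWordB 8) = 45 := by
  unfold failCount symWordB cwOf tripleOf sel affEval wt
  decide +kernel

/-- `OutHeavyButOne 8 (symWordB 8) cEight`: the same at the second optimum. -/
theorem outHeavyButOne_eightB : OutHeavyButOne 8 (symWordB 8) cEight := by
  refine ⟨isMinWord_cEight.1, fun Y hY hY0 hne => ?_⟩
  rw [failCount_symWordB_eight]
  exact outHeavy_eightB Y hY hY0 hne

/-- **`OutHeavyEight`** (Sketch14 §OutHeavy, verbatim statement; planner qa-qnc0-p1 gen 14, ask L31): at every
(symmetric) optimal `K0` of `C_8` the minimum word `cEight` is the only non-zero codeword with fewer than `45` points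
outside `Z(K0)`.  The symmetry hypothesis is not needed (`opt_eight`). -/
theorem outHeavyEight : OutHeavyEight := by
  intro K0 hK _
  refine ⟨cEight, isMinWord_cEight, ?_⟩
  rcases opt_eight hK with rfl | rfl
  · exact outHeavyButOne_eight
  · exact outHeavyButOne_eightB

/-- **ONE-WORD MI at `m = 8`** (Sketch14 `OneWordMIEight`, verbatim statement): the mass inequality holds at every
symmetric optimum of `C_8` for all column-codeword deviations supported on one minimum word — the first theorem in
the FAR regime of the MI programme (planner's chain `oneWordMIEight_of_outHeavyEight` [qn-prover g8] fed with
`outHeavyEight`). -/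
theorem oneWordMIEight : OneWordMIEight := oneWordMIEight_of_outHeavyEight outHeavyEight

/-- (★)(8, K0) at EVERY optimal codeword `K0` of `C_8` (no symmetry hypothesis): every outside word has a fractional
inside completion passing the column test. -/
theorem starCert_of_isOpt1_eight {K0 : (Fin 8 → Bool) → Bool} (hK : IsOpt1 8 K0) : StarCert 8 K0 := by
  rcases opt_eight hK with rfl | rfl
  · exact starCert_of_outHeavyButOne (sc1At_of_isOpt1 hK) outHeavyButOne_eight
  · exact starCert_of_outHeavyButOne (sc1At_of_isOpt1 hK) outHeavyButOne_eightB

/-- ONE-WORD MI at every optimal `K0` of `C_8`, symmetric or not (the two optima are both symmetric anyway). -/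
theorem oneWordMIAt_of_isOpt1_eight {K0 : (Fin 8 → Bool) → Bool} (hK : IsOpt1 8 K0) : OneWordMIAt 8 K0 :=
  oneWordOfRelMI 8 K0 (oneWordDecode 8) (relMIOfStar 8 K0 (starCert_of_isOpt1_eight hK))

/-! ### m = 7 -/

/-- `OutHeavyButOne 7 (symWordB 7) 0`: at the optimum of `C_7` every non-zero codeword has `≥ 16` outside points
(no exception: the named word is the zero word). -/
theorem outHeavyButOne_seven : OutHeavyButOne 7 (symWordB 7) (fun _ => false) := by
  refine ⟨isElim1_false 7, fun Y hY hY0 _ => ?_⟩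
  rw [failCount_symWordB_seven]
  exact outHeavy_seven Y hY hY0

/-- **`OutHeavySeven`** (Sketch14 §OutHeavy, verbatim statement): at the (unique, `opt_seven`) optimum of `C_7`
every non-zero codeword has at least `16 = |Z|` outside points. -/
theorem outHeavySeven : OutHeavySeven := by
  intro K0 hK _
  obtain rfl : K0 = symWordB 7 := opt_seven hK
  exact outHeavyButOne_seven

/-- (★)(7, K0) at the optimal codeword of `C_7`. -/
theorem starCert_of_isOpt1_seven {K0 : (Fin 7 → Bool) → Bool} (hK : IsOpt1 7 K0) : StarCert 7 K0 := by
  obtain rfl : K0 = symWordB 7 := opt_seven hK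
  exact starCert_of_outHeavyButOne (sc1At_of_isOpt1 hK) outHeavyButOne_seven

/-- ONE-WORD MI at the optimal codeword of `C_7`. -/
theorem oneWordMIAt_of_isOpt1_seven {K0 : (Fin 7 → Bool) → Bool} (hK : IsOpt1 7 K0) : OneWordMIAt 7 K0 :=
  oneWordOfRelMI 7 K0 (oneWordDecode 7) (relMIOfStar 7 K0 (starCert_of_isOpt1_seven hK))

end Summit.QuantumAdvantage.AdviceFreeQNC0
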